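import Summits.QuantumFields.YangMills.Theorems.BalabanUVNodesN15PerCubeGreenTwoGridEntryThreeNamedReg335HolderLetters
import Summits.QuantumFields.YangMills.Theorems.BalabanUVNodesN15PerCubeGreenTwoGridEntryThreeLettersBookkeeping
import Summits.QuantumFields.YangMills.Theorems.BalabanUVNodesN15PerCubeGreenTwoGridKnitDefectReg335Small
import HarnessLib

/-!
# N15 = NE2, road (c) — PROGRAMME (PC), (PC-E-N): n15-c∕385b (ENTRY 3, threshold discharged by n15-c∕385a's `entryThree_letters_bookkeeping`) FOR THE NAMED GREEN's FUNCTIONS on top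
# of n15-c∕394; `∃ δ w₀ c₀ D ρ₀`, majorant `D·((L^k)^{−1∕4} + o_B)·e^{−ρ₀|y−y′|_T}` and the `_explicit` edition; NO `∃ u′` (dag-n15-c g35, n15-c∕395)

Cell `pub-ymgap`, seat `pub-ymgap-dag-n15-c` (generation g35; R134 (a) seat, strategy s1 «first missing estimate»; HUMAN RULING D-0062; chair R424 venue).
`bears_on: R4∕N15 · K3⁸ SpineGivenEndpointR13SepCoPHV (stmt-QuantumFields-27366)`; filed `--kind proof --supports stmt-QuantumFields-27366 --as helper` — COUNT-NEUTRAL.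
TWO theorems, 0 `def`, 0 `sorry`: `uN_idef_scGreenOp_entryThree_of_reg335Holder_small` ∕ `…_small_explicit` = n15-c∕385b's two theorems VERBATIM with the parent replaced by n15-c∕394, the
conclusions stated for `Δ_{R_U′} ∘ scGreenOp′ … U′` ∕ `Δ_{R_U} ∘ scGreenOp … U` (n15-c∕388), the `⟨u′, hu′, ·⟩` threading removed.  Imports n15-c∕394, n15-c∕385a, n15-c∕355; generator HOME
`tools/g35/gf_wrap.py`; nothing in the tree is modified.
HONEST FRAMING ∕ LIMITS.  Bookkeeping over landed theorems (real algebra on the majorant only); MODEL two-grid setting (King tori, straight-holonomy pairing, one cube scale `ξ`); the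
datum is the typed per-cube class as a HYPOTHESIS; nothing of [B9]∕[B11] asserted.  NE2⁺ NOT PRINTED ∕ NOT proved; N15 of record untouched (DISCHARGED AS CONSUMED, p687738); K3⁸ OPEN;
counts of record UNMOVED (typed 28∕28 · discharged 8∕27); one finite 𝕋⁴ at fixed ε per index — NOT infinite volume, NOT OS on ℝ⁴, NOT a mass gap, NOT Clay.  Restate-immune (no Theses import).
-/




set_option autoImplicit false

noncomputable section

open scoped BigOperators Matrix Matrix.Norms.L2Operator
open Finset

namespace Summit.QuantumFields.YangMills.BalabanUVNodes.N15.Gluing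

open Real
open Literature.MathematicalPhysics.QuantumFieldTheory.Balaban1983to89
open Literature.MathematicalPhysics.QuantumFieldTheory.Balaban1983to89.B5Prop11Plancherel (Tor fine unitVec)
open Literature.MathematicalPhysics.QuantumFieldTheory.Balaban1983to89.B11SectG (BlockNorm HasMaj)
open Literature.MathematicalPhysics.QuantumFieldTheory.Balaban1983to89.T4EtaRateDefect (idef)
open Literature.MathematicalPhysics.QuantumFieldTheory.Balaban1983to89.B6UnitTorusCarrier (unitTorusGeo)
open Summit.QuantumFields.YangMills.BalabanUVNodes.N15.CurvedSpecies (Reg335HolderCube)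
open Literature.MathematicalPhysics.QuantumFieldTheory.King1986 (aK aK_pos aK_le)
open Literature.MathematicalPhysics.QuantumFieldTheory.King1986.Torus (tdistT)
open Literature.MathematicalPhysics.QuantumFieldTheory.Balaban1983to89.B7Prop10InLambdaRec (one_add_pow_sub_one_le)
open Literature.Barriers.QuantumFields (traceForm)
open Summit.QuantumFields.YangMills.BalabanUVNodes.N15.BackgroundLayer (tCoefA tCoefC covLapM)
open Summit.QuantumFields.YangMills.BalabanUVNodes.N15.VectorPiece (kingPr)
open Summit.QuantumFields.YangMills.BalabanUVNodes.N15.MatrixSpecies (coordMat basisConst basisConst_nonneg liftBlk liftMap)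
open Summit.QuantumFields.YangMills.BalabanUVNodes.N15.CurvedSpecies (gaugePair)
open Summit.QuantumFields.YangMills.BalabanUVNodes.N15.CovAvg (mprod kingSec ctauS)

variable {d : ℕ}

/-! ## §2 The small-data editions -/

section Small

variable {L : ℕ} [NeZero L]
set_option maxHeartbeats 3200000 in
/-- ★★★ n15-c∕385b (entry 3 of (3.42), ONE smallness condition) for THE NAMED scalar covariant Green's functions (NO `∃ u′`).  See the module docstring.
[cite: Balaban1985BackgroundPropagators, Thm 3.1 (3.42) p.397 (fourth entry: shape), (3.24)–(3.25) p.394, (3.35) p.396; Balaban1985Variational, Thm 1 (9) p.279 (shape); King1986, p.664 (pairing)] -/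
theorem uN_idef_scGreenOp_entryThree_of_reg335Holder_small (hL : Odd L ∧ 1 < L) (hL7 : 7 ≤ L) {a₀ : ℝ} (ha₀ : 0 < a₀) (ι : Type) [Fintype ι] [DecidableEq ι] :
    ∃ δ w₀ c₀ D ρ₀ : ℝ, 0 < δ ∧ 0 < c₀ ∧ 0 < ρ₀ ∧ 0 ≤ D ∧ ∀ (mv kk r : ℕ), 1 ≤ kk → 1 ≤ r → w₀ ≤ ((L ^ mv : ℕ) : ℝ) →
      ∀ {mm : Type} [Fintype mm] [DecidableEq mm] [Nonempty mm] (e : Matrix mm mm ℂ ≃L[ℝ] (ι → ℝ)), (∀ A B : Matrix mm mm ℂ, traceForm A B = e A ⬝ᵥ e B) →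
      ∀ (U' : Fin (d + 1) → ScX' d L mv kk r hL → (Matrix mm mm ℂ)ˣ), (∀ μ x', (U' μ x' : Matrix mm mm ℂ) ∈ Matrix.unitaryGroup mm ℂ) →
      ∀ (Q : (Fin (d + 1) → ZMod (2 * L)) → Set (ScX' d L mv kk r hL)) (ξ C β Cβ : ℝ), 0 < ξ → 0 ≤ C → 0 ≤ β → 0 ≤ Cβ →
        (1 + @basisConst ι _ (Matrix mm mm ℂ) Matrix.frobeniusNormedAddCommGroup Matrix.frobeniusNormedSpace e * (2 * Real.sqrt (Fintype.card mm)) * Real.sqrt (Fintype.card mm)) ^ 2 * (C / ξ + C / ξ ^ 2) ≤ c₀ →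
        (∀ k, Reg335HolderCube (scShift' d L mv kk r hL) U' ((((L ^ r * L ^ kk : ℕ) : ℝ))⁻¹) (Q k) ξ (fun z z' => ((((L ^ r * L ^ kk : ℕ) : ℝ))⁻¹) * tdistT (fine (L ^ r * L ^ kk) (cvM d L mv kk hL)) z z') C β Cβ) →
        (∀ k z, (∃ y ∈ cvSk d L mv kk hL k, (unitTorusGeo L kk (cvM d L mv kk hL)).dist (scBlk' d L mv kk r hL z) y ≤ 5) → z ∈ Q k) →
      ∀ (oB : ℝ), 0 ≤ oB →
        (@basisConst ι _ (Matrix mm mm ℂ) Matrix.frobeniusNormedAddCommGroup Matrix.frobeniusNormedSpace e * (((L ^ r * L ^ kk : ℕ) : ℝ) ^ 2 * (Fintype.card mm * (2 * (((((L ^ r * L ^ kk : ℕ) : ℝ))⁻¹) ^ 2 * ((Cβ * (ξ ^ (2 + β))⁻¹ * (2 * ((L ^ r : ℕ) : ℝ) * ((((L ^ r * L ^ kk : ℕ) : ℝ))⁻¹)) ^ β + 2 * ((((L ^ r * L ^ kk : ℕ) : ℝ))⁻¹) * ((C / ξ) * (C / ξ ^ 2))) * Real.exp (5 * (((((L ^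 r * L ^ kk : ℕ) : ℝ))⁻¹) * (C / ξ))))) + ((((L ^ r * L ^ kk : ℕ) : ℝ))⁻¹) ^ 2 * ((C / ξ ^ 2) * Real.exp (((((L ^ r * L ^ kk : ℕ) : ℝ))⁻¹) * (C / ξ))) * (((d + 1 : ℕ) : ℝ) * (((L ^ r - 1 : ℕ) : ℝ) * (((((L ^ r * L ^ kk : ℕ) : ℝ))⁻¹) ^ 2 * ((C / ξ ^ 2) * Real.exp (((((L ^ r * L ^ kk : ℕ) : ℝ))⁻¹) * (C / ξ)))))) + (((((L ^ r * L ^ kk : ℕ) : ℝ))⁻¹) ^ 2 * ((C / ξ ^ 2) * Real.exp (((((L ^ r * L ^ kk : ℕ) : ℝ))⁻¹) * (C / ξ))) + (((d + 1 : ℕ) : ℝ) * (((L ^ r - 1 : ℕ) : ℝ) * (((((L ^ r * L ^ kk : ℕ) : ℝ))⁻¹) ^ 2 * ((C / ξ ^ 2) * Real.exp (((((L ^ r * L ^ kk : ℕ) : ℝ))⁻¹) * (C / ξ)))))) + ((((L ^ r * L ^ kk : ℕ) : ℝ))⁻¹) ^ 2 * ((C / ξ ^ 2) * Real.exp (((((L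 ^ r * L ^ kk : ℕ) : ℝ))⁻¹) * (C / ξ)))) * (((((L ^ r * L ^ kk : ℕ) : ℝ))⁻¹) ^ 2 * ((C / ξ ^ 2) * Real.exp (((((L ^ r * L ^ kk : ℕ) : ℝ))⁻¹) * (C / ξ)))))) + Fintype.card mm * (2 * ((L ^ kk : ℕ) : ℝ) ^ 2 * (2 * ((L ^ r : ℕ) : ℝ) ^ 3 * ((((((L ^ r * L ^ kk : ℕ) : ℝ))⁻¹) * ((C / ξ) * Real.exp (((((L ^ r * L ^ kk : ℕ) : ℝ))⁻¹) * (C / ξ)))) * (((((L ^ r * L ^ kk : ℕ) : ℝ))⁻¹) ^ 2 * ((C / ξ ^ 2) * Real.exp (((((L ^ r * L ^ kk : ℕ) : ℝ))⁻¹) * (C / ξ))))) + ((L ^ r : ℕ) : ℝ) ^ 2 * (((((L ^ r * L ^ kk : ℕ) : ℝ))⁻¹) ^ 2 * ((Cβ * (ξ ^ (2 + β))⁻¹ * (2 * ((L ^ r : ℕ) : ℝ) * ((((L ^ r * L ^ kk : ℕ) : ℝ))⁻¹)) ^ β + 2 * ((((L ^ r * L ^ kk : ℕ) : ℝ))⁻¹)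 * ((C / ξ) * (C / ξ ^ 2))) * Real.exp (5 * (((((L ^ r * L ^ kk : ℕ) : ℝ))⁻¹) * (C / ξ)))))) + 2 * (((L ^ r : ℕ) : ℝ) * ((L ^ kk : ℕ) : ℝ)) ^ 2 * ((((L ^ r : ℕ) : ℝ) + 1) * (((((L ^ r * L ^ kk : ℕ) : ℝ))⁻¹) * ((C / ξ) * Real.exp (((((L ^ r * L ^ kk : ℕ) : ℝ))⁻¹) * (C / ξ)))) * (((((L ^ r * L ^ kk : ℕ) : ℝ))⁻¹) ^ 2 * ((C / ξ ^ 2) * Real.exp (((((L ^ r * L ^ kk : ℕ) : ℝ))⁻¹) * (C / ξ)))))))) ≤ oB →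
        HasMaj (ScNorm d L mv kk hL ι) (BlockNorm.ofBlocks (unitTorusGeo L kk (cvM d L mv kk hL)) (liftBlk (scBlk d L mv kk hL ∘ kingPr L kk r (cvM d L mv kk hL)) ι))
          (idef (ctauS (cvM d L mv kk hL) L kk r (fun μ x' => coordMat e (ContinuousLinearMap.mulLeftRight ℝ (Matrix mm mm ℂ) ((U' μ x' : Matrix mm mm ℂ)) ((U' μ x' : Matrix mm mm ℂ))ᴴ))) (ctauS (cvM d L mv kk hL) L kk r (fun μ x' => coordMat e (ContinuousLinearMap.mulLeftRight ℝ (Matrix mm mm ℂ) ((U' μ x' : Matrix mm mm ℂ)) ((U' μ x' : Matrix mm mm ℂ))ᴴ)))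
            (covLapM (scShift' d L mv kk r hL) ((((L ^ r * L ^ kk : ℕ) : ℝ))⁻¹) (gaugePair (scShift' d L mv kk r hL) (fun μ x => coordMat e (ContinuousLinearMap.mulLeftRight ℝ (Matrix mm mm ℂ) ((U' μ x : Matrix mm mm ℂ)) ((U' μ x : Matrix mm mm ℂ))ᴴ))) ∘ₗ (scGreenOp' d L mv kk r hL (aK a₀ (L : ℝ) (r + kk) * (((L ^ r * L ^ kk : ℕ) : ℝ)) ^ (d + 1)) ((((L ^ r * L ^ kk : ℕ) : ℝ))⁻¹) ι e (fun μ z => (U' μ z : Matrix mm mm ℂ))))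
            (covLapM (scShift d L mv kk hL) ((((L ^ kk : ℕ) : ℝ))⁻¹) (gaugePair (scShift d L mv kk hL) (fun μ x => coordMat e (ContinuousLinearMap.mulLeftRight ℝ (Matrix mm mm ℂ) (mprod (fun t => (U' μ (kingSec (cvM d L mv kk hL) L kk r x + t • unitVec (fine (L ^ r * L ^ kk) (cvM d L mv kk hL)) μ) : Matrix mm mm ℂ)) (L ^ r)) (mprod (fun t => (U' μ (kingSec (cvM d L mv kk hL) L kk r x + t • unitVec (fine (L ^ r * L ^ kk) (cvM d L mv kk hL)) μ) : Matrix mm mm ℂ)) (L ^ r))ᴴ))) ∘ₗ (scGreenOp d L mv kk hL (aK a₀ (L : ℝ) kk * (((L ^ kk : ℕ) : ℝ)) ^ (d + 1)) ((((L ^ kk : ℕ) : ℝ))⁻¹) ι e (fun μ y => mprod (fun t => (U' μ (kingSec (cvM d L mv kk hL) L kk r y + t • unitVec (fine (L ^ r * L ^ kk) (cvM d L mv kk hL)) μ) : Matrix mm mm ℂ)) (L ^ r)))))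
          (fun y y' => D * (((L : ℝ) ^ kk) ^ (-(1 / 4 : ℝ)) + oB) * Real.exp (-(ρ₀ * (unitTorusGeo L kk (cvM d L mv kk hL)).dist y y'))) := by
  obtain ⟨δ, w₀, R₀, D, B, c, ρ₀, hδ, hR₀, hρ₀, hD0, hB0, hc0, H⟩ := uN_idef_scGreenOp_entryThree_of_reg335Holder_letters (d := d) hL hL7 ha₀ ι
  have hLpos : 0 < L := (by have := hL.2; omega)
  have hL1r : (1 : ℝ) < (L : ℝ) := by exact_mod_cast hL.2
  have hL2r : (2 : ℝ) ≤ (L : ℝ) := by exact_mod_cast (show 2 ≤ L by have := hL.2; omega)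
  have hI0 : (0 : ℝ) ≤ (Fintype.card ι : ℝ) := Nat.cast_nonneg _
  have hdd0 : (0 : ℝ) ≤ (d : ℝ) := Nat.cast_nonneg _
  obtain ⟨K₁, hK₁⟩ : ∃ K₁ : ℝ, K₁ = (Fintype.card ι : ℝ) * (6 + ((d : ℝ) + 1) * (36 * (Fintype.card ι : ℝ) + 6)) := ⟨_, rfl⟩
  obtain ⟨K₂, hK₂⟩ : ∃ K₂ : ℝ, K₂ = (1 + 2 * ((d : ℝ) + 1)) + 2 * a₀ * (Fintype.card ι : ℝ) * (4 * ((d : ℝ) + 1) ^ 2 * (Fintype.card ι : ℝ) + 4 * ((d : ℝ) + 1)) := ⟨_, rfl⟩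
  obtain ⟨hK₁0, hK₂0⟩ : 0 ≤ K₁ ∧ 0 ≤ K₂ := ⟨by rw [hK₁]; positivity, by rw [hK₂]; positivity⟩
  obtain ⟨c₀, hc₀⟩ : ∃ c₀ : ℝ, c₀ = min (1 / (100 * ((d : ℝ) + 1) * ((Fintype.card ι : ℝ) + 1) * (K₁ + 1))) (R₀ / (K₁ * K₂ + 1)) := ⟨_, rfl⟩
  have hc₀pos : 0 < c₀ := by rw [hc₀]; exact lt_min (by positivity) (by positivity)
  have hc₀a : c₀ ≤ 1 / (100 * ((d : ℝ) + 1) * ((Fintype.card ι : ℝ) + 1) * (K₁ + 1)) := by rw [hc₀]; exact min_le_left _ _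
  have hc₀b : c₀ ≤ R₀ / (K₁ * K₂ + 1) := by rw [hc₀]; exact min_le_right _ _
  obtain ⟨KI, hKI⟩ : ∃ KI : ℝ, KI = (3 * ((d : ℝ) + 2) + 72 * (Fintype.card ι : ℝ)) * c₀ := ⟨_, rfl⟩
  obtain ⟨Aη, hAη⟩ : ∃ Aη : ℝ, Aη = ((Fintype.card ι : ℝ) * KI + (Fintype.card ι : ℝ) ^ 2 * ((d : ℝ) + 1) * KI) * (1 + 2 * ((d : ℝ) + 1)) +
      2 * a₀ * (Fintype.card ι : ℝ) ^ 2 * (((d : ℝ) + 1) * (3 * (d : ℝ) + 6) * c₀) + 12 * ((d : ℝ) + 1) * (Fintype.card ι : ℝ) * c₀ := ⟨_, rfl⟩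
  obtain ⟨Bc, hBc⟩ : ∃ Bc : ℝ, Bc = 2 * a₀ * (Fintype.card ι : ℝ) * (1 + (Fintype.card ι : ℝ)) := ⟨_, rfl⟩
  obtain ⟨KB, hKB⟩ : ∃ KB : ℝ, KB = (Fintype.card ι : ℝ) * ((d : ℝ) + 1) * (1 + 2 * ((d : ℝ) + 1)) := ⟨_, rfl⟩
  obtain ⟨KO, hKO⟩ : ∃ KO : ℝ, KO = Real.pi * ((d : ℝ) + 1) := ⟨_, rfl⟩
  obtain ⟨KOP, hKOP⟩ : ∃ KOP : ℝ, KOP = (a₀ * (Fintype.card ι : ℝ) ^ 2) * (Fintype.card ι : ℝ) * KO + (Fintype.card ι : ℝ) ^ 2 * (4 / 3 * a₀ + Bc + 2 * a₀ * (Fintype.card ι : ℝ) ^ 2 * (((d : ℝ) + 1) * (3 * (d : ℝ) + 12) * c₀) + (a₀ * (Fintype.card ι : ℝ) ^ 2) * (Fintype.card ι : ℝ) * KO + 2 * (a₀ * (Fintype.card ι : ℝ) ^ 2) * (12 * ((d : ℝ) + 1) * (Fintype.card ι : ℝ) * c₀)) := ⟨_, rfl⟩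
  have hKI0 : 0 ≤ (3 * ((d : ℝ) + 2) + 72 * (Fintype.card ι : ℝ)) * c₀ := by positivity
  obtain ⟨hAη0, hBc0, hKB0⟩ : 0 ≤ Aη ∧ 0 ≤ Bc ∧ 0 ≤ KB := ⟨by rw [hAη, hKI]; positivity, by rw [hBc]; positivity, by rw [hKB]; positivity⟩
  have hKO0 : 0 ≤ KO := by rw [hKO]; positivity
  have hKOP0 : 0 ≤ KOP := by rw [hKOP]; positivity
  obtain ⟨D3, hD3⟩ : ∃ D3 : ℝ, D3 = (a₀ * (Fintype.card ι : ℝ) ^ 2) * max D 0 * (1 + Aη + Bc + KB) * c + (Fintype.card (Fin (d + 1) → ZMod (2 * L)) : ℝ) * KOP * B * c := ⟨_, rfl⟩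
  have hD30 : 0 ≤ D3 := by rw [hD3]; positivity
  refine ⟨δ, w₀, c₀, D3, ρ₀, hδ, hc₀pos, hρ₀, hD30, fun mv kk r hk hr hw₀ => ?_⟩
  intro mm _ _ _ e he U' hU'g Q ξ C β Cβ hξ hC hβ hCβ hsmall h335 hQ oB hoB hBle
  have H1 := H mv kk r hk hr hw₀ e he U' hU'g Q ξ C β Cβ hξ hC hβ hCβ h335 hQ oB hoB hBle
  clear H
  have hκ := @basisConst_nonneg ι _ (Matrix mm mm ℂ) Matrix.frobeniusNormedAddCommGroup Matrix.frobeniusNormedSpace e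
  have hx1 : (1 : ℝ) ≤ (L : ℝ) ^ kk := one_le_pow₀ hL1r.le
  have hLk1 : (1 : ℝ) ≤ (((L ^ kk : ℕ) : ℝ)) := by exact_mod_cast Nat.one_le_pow _ _ hLpos
  have hLr1 : (1 : ℝ) ≤ ((L ^ r : ℕ) : ℝ) := by exact_mod_cast Nat.one_le_pow _ _ hLpos
  have hW1 : (1 : ℝ) ≤ ((L ^ mv : ℕ) : ℝ) := by exact_mod_cast Nat.one_le_pow _ _ hLpos
  have hηx4 : ((((L ^ kk : ℕ) : ℝ))⁻¹) ≤ ((L : ℝ) ^ kk) ^ (-(1 / 4 : ℝ)) := by rw [Nat.cast_pow]; exact (inv_le_rpow_neg_quarter hx1).1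
  have hOHox : Real.pi * (d + 1) / (((L ^ kk : ℕ) : ℝ) * ((L ^ mv : ℕ) : ℝ)) ≤ KO * ((L : ℝ) ^ kk) ^ (-(1 / 4 : ℝ)) := by
    calc Real.pi * (d + 1) / (((L ^ kk : ℕ) : ℝ) * ((L ^ mv : ℕ) : ℝ)) = Real.pi * (d + 1) * (((((L ^ kk : ℕ) : ℝ))⁻¹) * (((L ^ mv : ℕ) : ℝ))⁻¹) := by rw [div_eq_mul_inv, mul_inv]
      _ ≤ Real.pi * (d + 1) * (((((L ^ kk : ℕ) : ℝ))⁻¹) * 1) := by gcongr; exact inv_le_one_of_one_le₀ hW1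
      _ ≤ KO * ((L : ℝ) ^ kk) ^ (-(1 / 4 : ℝ)) := by rw [hKO, mul_one]; exact mul_le_mul_of_nonneg_left hηx4 (by positivity)
  have hMQx : 4 / 3 * a₀ * ((L : ℝ) ^ kk) ^ (-(2 : ℝ)) ≤ 4 / 3 * a₀ * ((L : ℝ) ^ kk) ^ (-(1 / 4 : ℝ)) := mul_le_mul_of_nonneg_left (Real.rpow_le_rpow_of_exponent_le hx1 (by norm_num)) (by positivity)
  have key := fun (y y' : Tor (cvM d L mv kk hL)) => entryThree_letters_bookkeeping ((Fintype.card ι : ℝ)) ((d : ℝ)) (((d + 1 : ℕ) : ℝ)) ((Fintype.card (Fin (d + 1)) : ℝ)) ((Fintype.card (Fin (d + 1) ⊕ Fin (d + 1)) : ℝ)) ((((L ^ r * L ^ kk : ℕ) : ℝ))) ((((L ^ kk : ℕ) : ℝ))) (((L ^ r : ℕ) : ℝ)) (((L ^ r - 1 : ℕ) : ℝ)) (((((L ^ r * L ^ kk : ℕ) : ℝ))⁻¹)) (((((L ^ kk : ℕ) : ℝ))⁻¹)) (@basisConst ι _ (Matrix mm mm ℂ) Matrix.frobeniusNormedAddCommGroup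 Matrix.frobeniusNormedSpace e * (2 * Real.sqrt (Fintype.card mm))) (Real.sqrt (Fintype.card mm)) ((C / ξ)) ((C / ξ ^ 2)) (((C / ξ) * Real.exp (((((L ^ r * L ^ kk : ℕ) : ℝ))⁻¹) * (C / ξ)))) (((C / ξ ^ 2) * Real.exp (((((L ^ r * L ^ kk : ℕ) : ℝ))⁻¹) * (C / ξ)))) (((1 + ((((L ^ r * L ^ kk : ℕ) : ℝ))⁻¹) * ((C / ξ) * Real.exp (((((L ^ r * L ^ kk : ℕ) : ℝ))⁻¹) * (C / ξ)))) ^ (L ^ r) - 1)) ((((1 + ((((L ^ r * L ^ kk : ℕ) : ℝ))⁻¹) * ((C / ξ) * Real.exp (((((L ^ r * L ^ kk : ℕ) : ℝ))⁻¹) * (C / ξ)))) ^ (L ^ r) - 1) / ((((L ^ kk : ℕ) : ℝ))⁻¹))) ((((C / ξ ^ 2) * Real.exp (((((L ^ r * L ^ kk : ℕ) : ℝ))⁻¹) * (C / ξ))) * (1 + ((((L ^ r * L ^ kk : ℕ) : ℝ))⁻¹) * ((C / ξ) * Real.exp (((((L ^ r * L ^ kk : ℕ) : ℝ))⁻¹)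 * (C / ξ)))) ^ (L ^ r))) ((@basisConst ι _ (Matrix mm mm ℂ) Matrix.frobeniusNormedAddCommGroup Matrix.frobeniusNormedSpace e * (2 * Real.sqrt (Fintype.card mm)) * (Real.sqrt (Fintype.card mm) * (((1 + ((((L ^ r * L ^ kk : ℕ) : ℝ))⁻¹) * ((C / ξ) * Real.exp (((((L ^ r * L ^ kk : ℕ) : ℝ))⁻¹) * (C / ξ)))) ^ (L ^ r) - 1) / ((((L ^ kk : ℕ) : ℝ))⁻¹))))) ((@basisConst ι _ (Matrix mm mm ℂ) Matrix.frobeniusNormedAddCommGroup Matrix.frobeniusNormedSpace e * (2 * Real.sqrt (Fintype.card mm)) * (Real.sqrt (Fintype.card mm) * (((C / ξ ^ 2) * Real.exp (((((L ^ r * L ^ kk : ℕ) : ℝ))⁻¹) * (C / ξ))) * (1 + ((((L ^ r * L ^ kk : ℕ) : ℝ))⁻¹) * ((C / ξ) * Real.exp (((((L ^ r * L ^ kk : ℕ) : ℝ))⁻¹) * (C / ξ)))) ^ (L ^ r))))) (((1 + ((((L ^ r * L ^ kk : ℕ) : ℝ))⁻¹) * (((1 + ((((L ^ r * L ^ kk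 : ℕ) : ℝ))⁻¹) * ((C / ξ) * Real.exp (((((L ^ r * L ^ kk : ℕ) : ℝ))⁻¹) * (C / ξ)))) ^ (L ^ r) - 1) / ((((L ^ kk : ℕ) : ℝ))⁻¹))) ^ (L ^ r) - 1)) (((((L ^ kk : ℕ) : ℝ)) * (@basisConst ι _ (Matrix mm mm ℂ) Matrix.frobeniusNormedAddCommGroup Matrix.frobeniusNormedSpace e * (2 * Real.sqrt (Fintype.card mm)) * (Real.sqrt (Fintype.card mm) * ((1 + ((((L ^ r * L ^ kk : ℕ) : ℝ))⁻¹) * (((1 + ((((L ^ r * L ^ kk : ℕ) : ℝ))⁻¹) * ((C / ξ) * Real.exp (((((L ^ r * L ^ kk : ℕ) : ℝ))⁻¹) * (C / ξ)))) ^ (L ^ r) - 1) / ((((L ^ kk : ℕ) : ℝ))⁻¹))) ^ (L ^ r) - 1))))) (((1 + Fintype.card ι * (((((L ^ r * L ^ kk : ℕ) : ℝ))⁻¹) * (@basisConst ι _ (Matrix mm mm ℂ) Matrix.frobeniusNormedAddCommGroup Matrix.frobeniusNormedSpace e * (2 * Real.sqrt (Fintype.card mm)) * (Real.sqrt (Fintype.card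 mm) * (((1 + ((((L ^ r * L ^ kk : ℕ) : ℝ))⁻¹) * ((C / ξ) * Real.exp (((((L ^ r * L ^ kk : ℕ) : ℝ))⁻¹) * (C / ξ)))) ^ (L ^ r) - 1) / ((((L ^ kk : ℕ) : ℝ))⁻¹)))))) ^ (L ^ r) - 1)) (((((d + 1 : ℕ) : ℝ) * ((L ^ r - 1 : ℕ) : ℝ) + (L ^ r : ℕ) + 1))) ((((L ^ r * L ^ kk : ℕ) : ℝ) * (@basisConst ι _ (Matrix mm mm ℂ) Matrix.frobeniusNormedAddCommGroup Matrix.frobeniusNormedSpace e * (2 * Real.sqrt (Fintype.card mm)) * (Real.sqrt (Fintype.card mm) * ((((d + 1 : ℕ) : ℝ) * ((L ^ r - 1 : ℕ) : ℝ) + (L ^ r : ℕ) + 1) * (((((L ^ r * L ^ kk : ℕ) : ℝ))⁻¹) ^ 2 * ((C / ξ ^ 2) * Real.exp (((((L ^ r * L ^ kk : ℕ) : ℝ))⁻¹) * (C / ξ)))))) + ((1 + Fintype.card ι * (((((L ^ r * L ^ kk : ℕ) : ℝ))⁻¹) * (@basisConst ι _ (Matrix mm mm ℂ) Matrix.frobeniusNormedAddCommGroup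 Matrix.frobeniusNormedSpace e * (2 * Real.sqrt (Fintype.card mm)) * (Real.sqrt (Fintype.card mm) * (((1 + ((((L ^ r * L ^ kk : ℕ) : ℝ))⁻¹) * ((C / ξ) * Real.exp (((((L ^ r * L ^ kk : ℕ) : ℝ))⁻¹) * (C / ξ)))) ^ (L ^ r) - 1) / ((((L ^ kk : ℕ) : ℝ))⁻¹)))))) ^ (L ^ r) - 1) * (((((L ^ r * L ^ kk : ℕ) : ℝ))⁻¹) * (@basisConst ι _ (Matrix mm mm ℂ) Matrix.frobeniusNormedAddCommGroup Matrix.frobeniusNormedSpace e * (2 * Real.sqrt (Fintype.card mm)) * (Real.sqrt (Fintype.card mm) * (((1 + ((((L ^ r * L ^ kk : ℕ) : ℝ))⁻¹) * ((C / ξ) * Real.exp (((((L ^ r * L ^ kk : ℕ) : ℝ))⁻¹) * (C / ξ)))) ^ (L ^ r) - 1) / ((((L ^ kk : ℕ) : ℝ))⁻¹)))))))) (Fintype.card ι * (((L ^ r * L ^ kk : ℕ) : ℝ) * (@basisConst ι _ (Matrix mm mm ℂ) Matrix.frobeniusNormedAddCommGroup Matrix.frobeniusNormedSpace e * (2 *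 Real.sqrt (Fintype.card mm)) * (Real.sqrt (Fintype.card mm) * ((((d + 1 : ℕ) : ℝ) * ((L ^ r - 1 : ℕ) : ℝ) + (L ^ r : ℕ) + 1) * (((((L ^ r * L ^ kk : ℕ) : ℝ))⁻¹) ^ 2 * ((C / ξ ^ 2) * Real.exp (((((L ^ r * L ^ kk : ℕ) : ℝ))⁻¹) * (C / ξ)))))) + ((1 + Fintype.card ι * (((((L ^ r * L ^ kk : ℕ) : ℝ))⁻¹) * (@basisConst ι _ (Matrix mm mm ℂ) Matrix.frobeniusNormedAddCommGroup Matrix.frobeniusNormedSpace e * (2 * Real.sqrt (Fintype.card mm)) * (Real.sqrt (Fintype.card mm) * (((1 + ((((L ^ r * L ^ kk : ℕ) : ℝ))⁻¹) * ((C / ξ) * Real.exp (((((L ^ r * L ^ kk : ℕ) : ℝ))⁻¹) * (C / ξ)))) ^ (L ^ r) - 1) / ((((L ^ kk : ℕ) : ℝ))⁻¹)))))) ^ (L ^ r) - 1) * (((((L ^ r * L ^ kk : ℕ) : ℝ))⁻¹) * (@basisConst ι _ (Matrix mm mm ℂ) Matrix.frobeniusNormedAddCommGroup Matrix.frobeniusNormedSpace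 e * (2 * Real.sqrt (Fintype.card mm)) * (Real.sqrt (Fintype.card mm) * (((1 + ((((L ^ r * L ^ kk : ℕ) : ℝ))⁻¹) * ((C / ξ) * Real.exp (((((L ^ r * L ^ kk : ℕ) : ℝ))⁻¹) * (C / ξ)))) ^ (L ^ r) - 1) / ((((L ^ kk : ℕ) : ℝ))⁻¹)))))))) (Fintype.card ι * (Fintype.card (Fin (d + 1)) * (oB + Fintype.card ι * ((((L ^ r * L ^ kk : ℕ) : ℝ) * (@basisConst ι _ (Matrix mm mm ℂ) Matrix.frobeniusNormedAddCommGroup Matrix.frobeniusNormedSpace e * (2 * Real.sqrt (Fintype.card mm)) * (Real.sqrt (Fintype.card mm) * ((((d + 1 : ℕ) : ℝ) * ((L ^ r - 1 : ℕ) : ℝ) + (L ^ r : ℕ) + 1) * (((((L ^ r * L ^ kk : ℕ) : ℝ))⁻¹) ^ 2 * ((C / ξ ^ 2) * Real.exp (((((L ^ r * L ^ kk : ℕ) : ℝ))⁻¹) * (C / ξ)))))) + ((1 + Fintype.card ι * (((((L ^ r * L ^ kk : ℕ) : ℝ))⁻¹) * (@basisConst ι _ (Matrix mm mm ℂ) Matrix.frobeniusNormedAddCommGroup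 Matrix.frobeniusNormedSpace e * (2 * Real.sqrt (Fintype.card mm)) * (Real.sqrt (Fintype.card mm) * (((1 + ((((L ^ r * L ^ kk : ℕ) : ℝ))⁻¹) * ((C / ξ) * Real.exp (((((L ^ r * L ^ kk : ℕ) : ℝ))⁻¹) * (C / ξ)))) ^ (L ^ r) - 1) / ((((L ^ kk : ℕ) : ℝ))⁻¹)))))) ^ (L ^ r) - 1) * (((((L ^ r * L ^ kk : ℕ) : ℝ))⁻¹) * (@basisConst ι _ (Matrix mm mm ℂ) Matrix.frobeniusNormedAddCommGroup Matrix.frobeniusNormedSpace e * (2 * Real.sqrt (Fintype.card mm)) * (Real.sqrt (Fintype.card mm) * (((1 + ((((L ^ r * L ^ kk : ℕ) : ℝ))⁻¹) * ((C / ξ) * Real.exp (((((L ^ r * L ^ kk : ℕ) : ℝ))⁻¹) * (C / ξ)))) ^ (L ^ r) - 1) / ((((L ^ kk : ℕ) : ℝ))⁻¹))))))) * ((@basisConst ι _ (Matrix mm mm ℂ) Matrix.frobeniusNormedAddCommGroup Matrix.frobeniusNormedSpace e * (2 * Real.sqrt (Fintype.card mm)) * (Real.sqrt (Fintype.card mm)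 * (((1 + ((((L ^ r * L ^ kk : ℕ) : ℝ))⁻¹) * ((C / ξ) * Real.exp (((((L ^ r * L ^ kk : ℕ) : ℝ))⁻¹) * (C / ξ)))) ^ (L ^ r) - 1) / ((((L ^ kk : ℕ) : ℝ))⁻¹)))) + (((L ^ kk : ℕ) : ℝ) * (@basisConst ι _ (Matrix mm mm ℂ) Matrix.frobeniusNormedAddCommGroup Matrix.frobeniusNormedSpace e * (2 * Real.sqrt (Fintype.card mm)) * (Real.sqrt (Fintype.card mm) * ((1 + ((((L ^ r * L ^ kk : ℕ) : ℝ))⁻¹) * (((1 + ((((L ^ r * L ^ kk : ℕ) : ℝ))⁻¹) * ((C / ξ) * Real.exp (((((L ^ r * L ^ kk : ℕ) : ℝ))⁻¹) * (C / ξ)))) ^ (L ^ r) - 1) / ((((L ^ kk : ℕ) : ℝ))⁻¹))) ^ (L ^ r) - 1))))))))) ((@basisConst ι _ (Matrix mm mm ℂ) Matrix.frobeniusNormedAddCommGroup Matrix.frobeniusNormedSpace e * (2 * Real.sqrt (Fintype.card mm)) * (Real.sqrt (Fintype.card mm) * ((d + 1) * (d * ((((L ^ r * L ^ kk : ℕ)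 : ℝ)) * (((L ^ r : ℕ) : ℝ) * (((((L ^ r * L ^ kk : ℕ) : ℝ))⁻¹) ^ 2 * ((C / ξ ^ 2) * Real.exp (((((L ^ r * L ^ kk : ℕ) : ℝ))⁻¹) * (C / ξ)))))) + ((1 + (((((L ^ r * L ^ kk : ℕ) : ℝ))⁻¹) * ((C / ξ) * Real.exp (((((L ^ r * L ^ kk : ℕ) : ℝ))⁻¹) * (C / ξ))))) ^ (L ^ r) - 1)))))) ((aK a₀ (L : ℝ) kk)) ((aK a₀ (L : ℝ) (r + kk))) ((Fintype.card ι * (|aK a₀ (L : ℝ) (r + kk) - aK a₀ (L : ℝ) kk| * (1 + Fintype.card ι) + |aK a₀ (L : ℝ) kk| * (2 * Fintype.card ι * (@basisConst ι _ (Matrix mm mm ℂ) Matrix.frobeniusNormedAddCommGroup Matrix.frobeniusNormedSpace e * (2 * Real.sqrt (Fintype.card mm)) * (Real.sqrt (Fintype.card mm) * ((d + 1) * (d * ((((L ^ r * L ^ kk : ℕ) : ℝ)) * (((L ^ r : ℕ) : ℝ) * (((((L ^ r * L ^ kk : ℕ) : ℝ))⁻¹) ^ 2 * ((C / ξ ^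 2) * Real.exp (((((L ^ r * L ^ kk : ℕ) : ℝ))⁻¹) * (C / ξ)))))) + ((1 + (((((L ^ r * L ^ kk : ℕ) : ℝ))⁻¹) * ((C / ξ) * Real.exp (((((L ^ r * L ^ kk : ℕ) : ℝ))⁻¹) * (C / ξ))))) ^ (L ^ r) - 1))))))))) ((Fintype.card ι * (@basisConst ι _ (Matrix mm mm ℂ) Matrix.frobeniusNormedAddCommGroup Matrix.frobeniusNormedSpace e * (2 * Real.sqrt (Fintype.card mm)) * (Real.sqrt (Fintype.card mm) * (((1 + ((((L ^ r * L ^ kk : ℕ) : ℝ))⁻¹) * ((C / ξ) * Real.exp (((((L ^ r * L ^ kk : ℕ) : ℝ))⁻¹) * (C / ξ)))) ^ (L ^ r) - 1) / ((((L ^ kk : ℕ) : ℝ))⁻¹)))) + Fintype.card ι * (Fintype.card (Fin (d + 1)) * (Fintype.card ι * (@basisConst ι _ (Matrix mm mm ℂ) Matrix.frobeniusNormedAddCommGroup Matrix.frobeniusNormedSpace e * (2 * Real.sqrt (Fintype.card mm)) * (Real.sqrt (Fintype.card mm) * (((1 + ((((L ^ r * L ^ kk : ℕ) : ℝ))⁻¹)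 * ((C / ξ) * Real.exp (((((L ^ r * L ^ kk : ℕ) : ℝ))⁻¹) * (C / ξ)))) ^ (L ^ r) - 1) / ((((L ^ kk : ℕ) : ℝ))⁻¹)))) ^ 2 + (@basisConst ι _ (Matrix mm mm ℂ) Matrix.frobeniusNormedAddCommGroup Matrix.frobeniusNormedSpace e * (2 * Real.sqrt (Fintype.card mm)) * (Real.sqrt (Fintype.card mm) * (((C / ξ ^ 2) * Real.exp (((((L ^ r * L ^ kk : ℕ) : ℝ))⁻¹) * (C / ξ))) * (1 + ((((L ^ r * L ^ kk : ℕ) : ℝ))⁻¹) * ((C / ξ) * Real.exp (((((L ^ r * L ^ kk : ℕ) : ℝ))⁻¹) * (C / ξ)))) ^ (L ^ r)))))))) (((1 + (Fintype.card ι * (@basisConst ι _ (Matrix mm mm ℂ) Matrix.frobeniusNormedAddCommGroup Matrix.frobeniusNormedSpace e * (2 * Real.sqrt (Fintype.card mm)) * (Real.sqrt (Fintype.card mm) * (((1 + ((((L ^ r * L ^ kk : ℕ) : ℝ))⁻¹) * ((C / ξ) * Real.exp (((((L ^ r * L ^ kk : ℕ) : ℝ))⁻¹) * (C / ξ)))) ^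 (L ^ r) - 1) / ((((L ^ kk : ℕ) : ℝ))⁻¹)))) + Fintype.card ι * (Fintype.card (Fin (d + 1)) * (Fintype.card ι * (@basisConst ι _ (Matrix mm mm ℂ) Matrix.frobeniusNormedAddCommGroup Matrix.frobeniusNormedSpace e * (2 * Real.sqrt (Fintype.card mm)) * (Real.sqrt (Fintype.card mm) * (((1 + ((((L ^ r * L ^ kk : ℕ) : ℝ))⁻¹) * ((C / ξ) * Real.exp (((((L ^ r * L ^ kk : ℕ) : ℝ))⁻¹) * (C / ξ)))) ^ (L ^ r) - 1) / ((((L ^ kk : ℕ) : ℝ))⁻¹)))) ^ 2 + (@basisConst ι _ (Matrix mm mm ℂ) Matrix.frobeniusNormedAddCommGroup Matrix.frobeniusNormedSpace e * (2 * Real.sqrt (Fintype.card mm)) * (Real.sqrt (Fintype.card mm) * (((C / ξ ^ 2) * Real.exp (((((L ^ r * L ^ kk : ℕ) : ℝ))⁻¹) * (C / ξ))) * (1 + ((((L ^ r * L ^ kk : ℕ) : ℝ))⁻¹) * ((C / ξ) * Real.exp (((((L ^ r * L ^ kk : ℕ) : ℝ))⁻¹) * (C / ξ)))) ^ (L ^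 r))))))) * ((((L ^ kk : ℕ) : ℝ))⁻¹)) ^ ((d + 1) * L ^ kk) - 1)) (((1 + (Fintype.card ι * (@basisConst ι _ (Matrix mm mm ℂ) Matrix.frobeniusNormedAddCommGroup Matrix.frobeniusNormedSpace e * (2 * Real.sqrt (Fintype.card mm)) * (Real.sqrt (Fintype.card mm) * (((1 + ((((L ^ r * L ^ kk : ℕ) : ℝ))⁻¹) * ((C / ξ) * Real.exp (((((L ^ r * L ^ kk : ℕ) : ℝ))⁻¹) * (C / ξ)))) ^ (L ^ r) - 1) / ((((L ^ kk : ℕ) : ℝ))⁻¹)))) + Fintype.card ι * (Fintype.card (Fin (d + 1)) * (Fintype.card ι * (@basisConst ι _ (Matrix mm mm ℂ) Matrix.frobeniusNormedAddCommGroup Matrix.frobeniusNormedSpace e * (2 * Real.sqrt (Fintype.card mm)) * (Real.sqrt (Fintype.card mm) * (((1 + ((((L ^ r * L ^ kk : ℕ) : ℝ))⁻¹) * ((C / ξ) * Real.exp (((((L ^ r * L ^ kk : ℕ) : ℝ))⁻¹) * (C / ξ)))) ^ (L ^ r) - 1) / ((((L ^ kk : ℕ) : ℝ))⁻¹)))) ^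 2 + (@basisConst ι _ (Matrix mm mm ℂ) Matrix.frobeniusNormedAddCommGroup Matrix.frobeniusNormedSpace e * (2 * Real.sqrt (Fintype.card mm)) * (Real.sqrt (Fintype.card mm) * (((C / ξ ^ 2) * Real.exp (((((L ^ r * L ^ kk : ℕ) : ℝ))⁻¹) * (C / ξ))) * (1 + ((((L ^ r * L ^ kk : ℕ) : ℝ))⁻¹) * ((C / ξ) * Real.exp (((((L ^ r * L ^ kk : ℕ) : ℝ))⁻¹) * (C / ξ)))) ^ (L ^ r))))))) * ((((L ^ r * L ^ kk : ℕ) : ℝ))⁻¹)) ^ ((d + 1) * (L ^ r * L ^ kk)) - 1)) (((1 + (Fintype.card ι * (((((L ^ r * L ^ kk : ℕ) : ℝ))⁻¹) * (@basisConst ι _ (Matrix mm mm ℂ) Matrix.frobeniusNormedAddCommGroup Matrix.frobeniusNormedSpace e * (2 * Real.sqrt (Fintype.card mm)) * (Real.sqrt (Fintype.card mm) * (((1 + ((((L ^ r * L ^ kk : ℕ) : ℝ))⁻¹) * ((C / ξ) * Real.exp (((((L ^ r * L ^ kk : ℕ) : ℝ))⁻¹) * (C / ξ)))) ^ (L ^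 r) - 1) / ((((L ^ kk : ℕ) : ℝ))⁻¹))))))) ^ ((d + 1) * (L ^ r - 1)) - 1)) ((((L : ℝ) ^ kk) ^ (-(1 / 4 : ℝ)))) ((((L : ℝ) ^ (2 * kk))⁻¹)) oB a₀ R₀ K₁ K₂ c₀ KI Aη Bc KB D (Real.exp (-(ρ₀ * (unitTorusGeo L kk (cvM d L mv kk hL)).dist y y')))
    (L ^ r) ((d + 1) * L ^ kk) ((d + 1) * (L ^ r * L ^ kk)) ((d + 1) * (L ^ r - 1))
    hI0 hdd0 (by push_cast; ring) (by simp) (by simp [Fintype.card_sum]; ring) ha₀ hK₁ hK₂ hc₀pos hc₀a hc₀b hKI hAη hBc hKB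
    hLk1 hLr1 (by rw [Nat.cast_mul]) (by rw [Nat.cast_sub (Nat.one_le_pow _ _ hLpos), Nat.cast_one]) rfl rfl
    rfl (by push_cast; ring) (by push_cast; ring) (by rw [Nat.cast_mul, Nat.cast_sub (Nat.one_le_pow _ _ hLpos)]; push_cast; ring)
    (by positivity) (Real.sqrt_nonneg _) (by positivity) (by positivity) hsmall rfl rfl rfl rfl rfl rfl rfl rfl rfl rfl rfl rfl rfl rfl rfl
    (by rw [abs_of_pos (aK_pos ha₀ hL1r hk)]; exact aK_le ha₀ hL1r hk) (abs_aK_sub_aK_le ha₀ hL2r hk r) rfl rfl rfl rfl rfl (by positivity)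
    (by rw [Nat.cast_pow]; exact (inv_le_rpow_neg_quarter hx1).1) (by rw [mul_comm, pow_mul]; exact (inv_le_rpow_neg_quarter hx1).2) (hoB) (Real.exp_pos _)
    (a₀ * (Fintype.card ι : ℝ) ^ 2) B c (Fintype.card (Fin (d + 1) → ZMod (2 * L)) : ℝ) KO (Real.pi * (d + 1) / (((L ^ kk : ℕ) : ℝ) * ((L ^ mv : ℕ) : ℝ))) (4 / 3 * a₀ * ((L : ℝ) ^ kk) ^ (-(2 : ℝ))) ((1 + (Fintype.card ι * (@basisConst ι _ (Matrix mm mm ℂ) Matrix.frobeniusNormedAddCommGroup Matrix.frobeniusNormedSpace e * (2 * Real.sqrt (Fintype.card mm)) * (Real.sqrt (Fintype.card mm) * (((((L ^ r * L ^ kk : ℕ) : ℝ))⁻¹) * (((1 + ((((L ^ r * L ^ kk : ℕ) : ℝ))⁻¹) * ((C / ξ) * Real.exp (((((L ^ r * L ^ kk : ℕ) : ℝ))⁻¹) * (C / ξ)))) ^ (L ^ r) - 1) / ((((L ^ kk : ℕ) : ℝ))⁻¹))))))) ^ ((d + 1) * (L ^ r - 1)) - 1) (Fintype.card ι * (|aK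 a₀ (L : ℝ) (r + kk) - aK a₀ (L : ℝ) kk| * (1 + Fintype.card ι) + |aK a₀ (L : ℝ) kk| * (2 * Fintype.card ι * (@basisConst ι _ (Matrix mm mm ℂ) Matrix.frobeniusNormedAddCommGroup Matrix.frobeniusNormedSpace e * (2 * Real.sqrt (Fintype.card mm)) * (Real.sqrt (Fintype.card mm) * ((d + 1) * (d * ((((L ^ r * L ^ kk : ℕ) : ℝ)) * (((L ^ r : ℕ) : ℝ) * (((((L ^ r * L ^ kk : ℕ) : ℝ))⁻¹) ^ 2 * ((C / ξ ^ 2) * Real.exp (((((L ^ r * L ^ kk : ℕ) : ℝ))⁻¹) * (C / ξ)))))) + ((1 + (((((L ^ r * L ^ kk : ℕ) : ℝ))⁻¹) * (((1 + ((((L ^ r * L ^ kk : ℕ) : ℝ))⁻¹) * ((C / ξ) * Real.exp (((((L ^ r * L ^ kk : ℕ) : ℝ))⁻¹) * (C / ξ)))) ^ (L ^ r) - 1) / ((((L ^ kk : ℕ) : ℝ))⁻¹)))) ^ (L ^ r) - 1)))))))) KOP rfl hB0 hc0 (by positivity) hKO0 hOHox hMQx rfl rfl hKOP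
  have hmain := H1 (key (0 : Tor (cvM d L mv kk hL)) 0).1
  exact hmain.mono fun y y' => by rw [hD3]; exact (key y y').2

set_option maxHeartbeats 800000 in
/-- ★★★ `uN_idef_scGreenOp_entryThree_of_reg335Holder_small` at `o_B := o_B^{H,expl}` (NO `∃ u′`). [cite: Balaban1985BackgroundPropagators, Thm 3.1 (3.42) p.397 (shape), (3.35) p.396; King1986, p.664 (pairing)] -/
theorem uN_idef_scGreenOp_entryThree_of_reg335Holder_small_explicit (hL : Odd L ∧ 1 < L) (hL7 : 7 ≤ L) {a₀ : ℝ} (ha₀ : 0 < a₀) (ι : Type) [Fintype ι] [DecidableEq ι] :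
    ∃ δ w₀ c₀ D ρ₀ : ℝ, 0 < δ ∧ 0 < c₀ ∧ 0 < ρ₀ ∧ 0 ≤ D ∧ ∀ (mv kk r : ℕ), 1 ≤ kk → 1 ≤ r → w₀ ≤ ((L ^ mv : ℕ) : ℝ) →
      ∀ {mm : Type} [Fintype mm] [DecidableEq mm] [Nonempty mm] (e : Matrix mm mm ℂ ≃L[ℝ] (ι → ℝ)), (∀ A B : Matrix mm mm ℂ, traceForm A B = e A ⬝ᵥ e B) →
      ∀ (U' : Fin (d + 1) → ScX' d L mv kk r hL → (Matrix mm mm ℂ)ˣ), (∀ μ x', (U' μ x' : Matrix mm mm ℂ) ∈ Matrix.unitaryGroup mm ℂ) →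
      ∀ (Q : (Fin (d + 1) → ZMod (2 * L)) → Set (ScX' d L mv kk r hL)) (ξ C β Cβ : ℝ), 0 < ξ → 0 ≤ C → 0 ≤ β → 0 ≤ Cβ →
        (1 + @basisConst ι _ (Matrix mm mm ℂ) Matrix.frobeniusNormedAddCommGroup Matrix.frobeniusNormedSpace e * (2 * Real.sqrt (Fintype.card mm)) * Real.sqrt (Fintype.card mm)) ^ 2 * (C / ξ + C / ξ ^ 2) ≤ c₀ →
        (∀ k, Reg335HolderCube (scShift' d L mv kk r hL) U' ((((L ^ r * L ^ kk : ℕ) : ℝ))⁻¹) (Q k) ξ (fun z z' => ((((L ^ r * L ^ kk : ℕ) : ℝ))⁻¹) * tdistT (fine (L ^ r * L ^ kk) (cvM d L mv kk hL)) z z') C β Cβ) →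
        (∀ k z, (∃ y ∈ cvSk d L mv kk hL k, (unitTorusGeo L kk (cvM d L mv kk hL)).dist (scBlk' d L mv kk r hL z) y ≤ 5) → z ∈ Q k) →
        HasMaj (ScNorm d L mv kk hL ι) (BlockNorm.ofBlocks (unitTorusGeo L kk (cvM d L mv kk hL)) (liftBlk (scBlk d L mv kk hL ∘ kingPr L kk r (cvM d L mv kk hL)) ι))
          (idef (ctauS (cvM d L mv kk hL) L kk r (fun μ x' => coordMat e (ContinuousLinearMap.mulLeftRight ℝ (Matrix mm mm ℂ) ((U' μ x' : Matrix mm mm ℂ)) ((U' μ x' : Matrix mm mm ℂ))ᴴ))) (ctauS (cvM d L mv kk hL) L kk r (fun μ x' => coordMat e (ContinuousLinearMap.mulLeftRight ℝ (Matrix mm mm ℂ) ((U' μ x' : Matrix mm mm ℂ)) ((U' μ x' : Matrix mm mm ℂ))ᴴ)))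
            (covLapM (scShift' d L mv kk r hL) ((((L ^ r * L ^ kk : ℕ) : ℝ))⁻¹) (gaugePair (scShift' d L mv kk r hL) (fun μ x => coordMat e (ContinuousLinearMap.mulLeftRight ℝ (Matrix mm mm ℂ) ((U' μ x : Matrix mm mm ℂ)) ((U' μ x : Matrix mm mm ℂ))ᴴ))) ∘ₗ (scGreenOp' d L mv kk r hL (aK a₀ (L : ℝ) (r + kk) * (((L ^ r * L ^ kk : ℕ) : ℝ)) ^ (d + 1)) ((((L ^ r * L ^ kk : ℕ) : ℝ))⁻¹) ι e (fun μ z => (U' μ z : Matrix mm mm ℂ))))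
            (covLapM (scShift d L mv kk hL) ((((L ^ kk : ℕ) : ℝ))⁻¹) (gaugePair (scShift d L mv kk hL) (fun μ x => coordMat e (ContinuousLinearMap.mulLeftRight ℝ (Matrix mm mm ℂ) (mprod (fun t => (U' μ (kingSec (cvM d L mv kk hL) L kk r x + t • unitVec (fine (L ^ r * L ^ kk) (cvM d L mv kk hL)) μ) : Matrix mm mm ℂ)) (L ^ r)) (mprod (fun t => (U' μ (kingSec (cvM d L mv kk hL) L kk r x + t • unitVec (fine (L ^ r * L ^ kk) (cvM d L mv kk hL)) μ) : Matrix mm mm ℂ)) (L ^ r))ᴴ))) ∘ₗ (scGreenOp d L mv kk hL (aK a₀ (L : ℝ) kk * (((L ^ kk : ℕ) : ℝ)) ^ (d + 1)) ((((L ^ kk : ℕ) : ℝ))⁻¹) ι e (fun μ y => mprod (fun t => (U' μ (kingSec (cvM d L mv kk hL) L kk r y + t • unitVec (fine (L ^ r * L ^ kk) (cvM d L mv kk hL)) μ) : Matrix mm mm ℂ)) (L ^ r)))))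
          (fun y y' => D * (((L : ℝ) ^ kk) ^ (-(1 / 4 : ℝ)) + (@basisConst ι _ (Matrix mm mm ℂ) Matrix.frobeniusNormedAddCommGroup Matrix.frobeniusNormedSpace e * (((L ^ r * L ^ kk : ℕ) : ℝ) ^ 2 * (Fintype.card mm * (2 * (((((L ^ r * L ^ kk : ℕ) : ℝ))⁻¹) ^ 2 * ((Cβ * (ξ ^ (2 + β))⁻¹ * (2 * ((L ^ r : ℕ) : ℝ) * ((((L ^ r * L ^ kk : ℕ) : ℝ))⁻¹)) ^ β + 2 * ((((L ^ r * L ^ kk : ℕ) : ℝ))⁻¹) * ((C / ξ) * (C / ξ ^ 2))) * Real.exp (5 * (((((L ^ r * L ^ kk : ℕ) : ℝ))⁻¹) * (C / ξ))))) + ((((L ^ r * L ^ kk : ℕ) : ℝ))⁻¹) ^ 2 * ((C / ξ ^ 2) * Real.exp (((((L ^ r * L ^ kk : ℕ) : ℝ))⁻¹) * (C / ξ))) * (((d + 1 : ℕ) : ℝ) * (((L ^ r - 1 : ℕ) : ℝ) * (((((L ^ r * L ^ kk : ℕ) : ℝ))⁻¹) ^ 2 * ((C / ξ ^ 2) * Real.exp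 (((((L ^ r * L ^ kk : ℕ) : ℝ))⁻¹) * (C / ξ)))))) + (((((L ^ r * L ^ kk : ℕ) : ℝ))⁻¹) ^ 2 * ((C / ξ ^ 2) * Real.exp (((((L ^ r * L ^ kk : ℕ) : ℝ))⁻¹) * (C / ξ))) + (((d + 1 : ℕ) : ℝ) * (((L ^ r - 1 : ℕ) : ℝ) * (((((L ^ r * L ^ kk : ℕ) : ℝ))⁻¹) ^ 2 * ((C / ξ ^ 2) * Real.exp (((((L ^ r * L ^ kk : ℕ) : ℝ))⁻¹) * (C / ξ)))))) + ((((L ^ r * L ^ kk : ℕ) : ℝ))⁻¹) ^ 2 * ((C / ξ ^ 2) * Real.exp (((((L ^ r * L ^ kk : ℕ) : ℝ))⁻¹) * (C / ξ)))) * (((((L ^ r * L ^ kk : ℕ) : ℝ))⁻¹) ^ 2 * ((C / ξ ^ 2) * Real.exp (((((L ^ r * L ^ kk : ℕ) : ℝ))⁻¹) * (C / ξ)))))) + Fintype.card mm * (2 * ((L ^ kk : ℕ) : ℝ) ^ 2 * (2 * ((L ^ r : ℕ) : ℝ) ^ 3 * ((((((L ^ r * L ^ kk : ℕ) : ℝ))⁻¹)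 * ((C / ξ) * Real.exp (((((L ^ r * L ^ kk : ℕ) : ℝ))⁻¹) * (C / ξ)))) * (((((L ^ r * L ^ kk : ℕ) : ℝ))⁻¹) ^ 2 * ((C / ξ ^ 2) * Real.exp (((((L ^ r * L ^ kk : ℕ) : ℝ))⁻¹) * (C / ξ))))) + ((L ^ r : ℕ) : ℝ) ^ 2 * (((((L ^ r * L ^ kk : ℕ) : ℝ))⁻¹) ^ 2 * ((Cβ * (ξ ^ (2 + β))⁻¹ * (2 * ((L ^ r : ℕ) : ℝ) * ((((L ^ r * L ^ kk : ℕ) : ℝ))⁻¹)) ^ β + 2 * ((((L ^ r * L ^ kk : ℕ) : ℝ))⁻¹) * ((C / ξ) * (C / ξ ^ 2))) * Real.exp (5 * (((((L ^ r * L ^ kk : ℕ) : ℝ))⁻¹) * (C / ξ)))))) + 2 * (((L ^ r : ℕ) : ℝ) * ((L ^ kk : ℕ) : ℝ)) ^ 2 * ((((L ^ r : ℕ) : ℝ) + 1) * (((((L ^ r * L ^ kk : ℕ) : ℝ))⁻¹) * ((C / ξ) * Real.exp (((((L ^ r * L ^ kk : ℕ) : ℝ))⁻¹) * (C / ξ))))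 * (((((L ^ r * L ^ kk : ℕ) : ℝ))⁻¹) ^ 2 * ((C / ξ ^ 2) * Real.exp (((((L ^ r * L ^ kk : ℕ) : ℝ))⁻¹) * (C / ξ))))))))) * Real.exp (-(ρ₀ * (unitTorusGeo L kk (cvM d L mv kk hL)).dist y y'))) := by
  obtain ⟨δ, w₀, c₀, D, ρ₀, hδ, hc₀, hρ₀, hD0, H⟩ := uN_idef_scGreenOp_entryThree_of_reg335Holder_small (d := d) hL hL7 ha₀ ι
  refine ⟨δ, w₀, c₀, D, ρ₀, hδ, hc₀, hρ₀, hD0, fun mv kk r hk hr hw₀ => ?_⟩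
  intro mm _ _ _ e he U' hU'g Q ξ C β Cβ hξ hC hβ hCβ hsmall h335 hQ
  have hκ := @basisConst_nonneg ι _ (Matrix mm mm ℂ) Matrix.frobeniusNormedAddCommGroup Matrix.frobeniusNormedSpace e
  exact H mv kk r hk hr hw₀ e he U' hU'g Q ξ C β Cβ hξ hC hβ hCβ hsmall h335 hQ _ (by positivity) le_rfl

end Small

end Summit.QuantumFields.YangMills.BalabanUVNodes.N15.Gluing

end
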